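import Summits.AtomisticToContinuum.Crystallization.Theorems.FrustratedLawDichotomyDoublingUnit
import Summits.AtomisticToContinuum.Crystallization.Theorems.FrustratedLawDichotomyAperiodicGapCountableCut

/-!
# FrustratedLawDichotomy · crux `AperiodicFrustratedLawGap` (stmt-AtomisticToContinuum-27623) — COUNTEREXAMPLES HAVE A 1-RELATIVELY-DENSE DIFFERENCE SET
# (decomp-a2c, prover hand 2, generation 2; sharpening generation 0's `…AperiodicGapNoPairCut` / `…DenseDifferences` from threshold `2` to `1`)

With the unit-threshold doubling (`FrustratedLawDichotomyDoublingUnit.eStar_lt_integral_rootEnergy_of_ae_unitNoPair`): the unit no-pair events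
(`measurableSet_unitNoPairEvent`, `mem_unitNoPairEvent_iff`, `unitNoPairEvent_invariant`), the cuts `aperiodicFrustratedLawGap_iff_offUnitNoPair`,
`aperiodicFrustratedLawGap_iff_offAllUnitNoPair`, and **`aperiodicFrustratedLawGap_iff_unitDenseDifferences`**: granted the floor of item 9229, the
crux (route decl BY NAME) is equivalent to its restriction to laws almost surely carried by configurations whose difference set meets EVERY ball of
radius `1 + ε`: `∀ v ε>0 ∃ atoms s s′, ‖s − s′ + v‖ < 1 + ε`.  Proofs verbatim from generation 0 with the constant replaced.  All `[folklore]`.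
-/

noncomputable section

namespace Summit.AtomisticToContinuum.Crystallization.Theorems.FrustratedLawDichotomyAperiodicGapFiniteCut

open MeasureTheory Metric Set Filter ProbabilityTheory TopologicalSpace
open scoped ENNReal Topology BigOperators
open Literature.MathematicalPhysics.StatisticalMechanics Literature.Probability.Process
open Summit.AtomisticToContinuum.Crystallization.Theorems.ChargedEnergyGapNegative (E3 eStar)
open Summit.AtomisticToContinuum.Crystallization.Theorems.FrustratedLawDichotomyFiniteClusterGap
  (ae_mem_of_sep card_mul_eStar_lt_interactionEnergy eStar_lt_integral_rootEnergy_of_ae_unitNoPair)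

section UnitNoPair

variable {δ : ℝ} {P : Measure (Measure E3)}

/-- The no-pair event is Giry-measurable (countably many ball evaluations). [folklore] -/
theorem measurableSet_unitNoPairEvent (w : EuclideanSpace ℝ (Fin 3)) :
    MeasurableSet {ν : Measure E3 | ∀ n m : ℕ, ∀ r : ℚ, (0 : ℝ) < r → ‖denseSeq E3 n - denseSeq E3 m + w‖ < 1 - 2 * (r : ℝ) → ν (ball (denseSeq E3 n) r) = 0 ∨ ν (ball (denseSeq E3 m) r) = 0} := by
  simp only [Set.setOf_forall]
  refine MeasurableSet.iInter fun n => MeasurableSet.iInter fun m => MeasurableSet.iInter fun (r : ℚ) =>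
    MeasurableSet.iInter fun _ => MeasurableSet.iInter fun _ => ?_
  have : {ν : Measure E3 | ν (ball (denseSeq E3 n) r) = 0 ∨ ν (ball (denseSeq E3 m) r) = 0} =
      {ν : Measure E3 | ν (ball (denseSeq E3 n) r) = 0} ∪ {ν : Measure E3 | ν (ball (denseSeq E3 m) r) = 0} := by
    ext ν; simp only [Set.mem_setOf_eq, Set.mem_union]
  rw [this]
  exact ((Measure.measurable_coe measurableSet_ball) (measurableSet_singleton 0)).union
    ((Measure.measurable_coe measurableSet_ball) (measurableSet_singleton 0))

/-- **On rooted hard-core configurations the no-pair event IS the no-pair property**: `count|S` (`S` separated) satisfies the countable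
ball conditions iff `1 ≤ ‖s − s' + w‖` for all atoms `s, s'`. [folklore] -/
theorem mem_unitNoPairEvent_iff {μ : Measure E3} (hμ : IsRootedHardCore δ μ) (w : EuclideanSpace ℝ (Fin 3)) :
    μ ∈ {ν : Measure E3 | ∀ n m : ℕ, ∀ r : ℚ, (0 : ℝ) < r → ‖denseSeq E3 n - denseSeq E3 m + w‖ < 1 - 2 * (r : ℝ) → ν (ball (denseSeq E3 n) r) = 0 ∨ ν (ball (denseSeq E3 m) r) = 0} ↔ ∀ s s' : E3, μ {s} ≠ 0 → μ {s'} ≠ 0 → 1 ≤ ‖s - s' + w‖ := by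
  obtain ⟨S, h0, hsep, rfl⟩ := hμ
  have hmem : ∀ s, (Measure.count : Measure E3).restrict S {s} ≠ 0 ↔ s ∈ S := count_restrict_singleton_ne_zero_iff S
  have hball : ∀ (c : E3) (r : ℝ), (Measure.count : Measure E3).restrict S (ball c r) = 0 ↔ ∀ s ∈ S, r ≤ dist s c := by
    intro c r
    rw [Measure.restrict_apply measurableSet_ball, Measure.count_eq_zero_iff, Set.eq_empty_iff_forall_notMem]
    constructor
    · intro h s hs
      by_contra hlt
      exact h s ⟨mem_ball.2 (lt_of_not_ge hlt), hs⟩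
    · rintro h s ⟨hsb, hs⟩
      exact absurd (mem_ball.1 hsb) (not_lt.2 (h s hs))
  have hdense := denseRange_denseSeq E3
  simp only [Set.mem_setOf_eq]
  constructor
  · -- countable conditions ⇒ the property
    intro h s s' hs hs'
    rw [hmem] at hs hs'
    by_contra hlt
    rw [not_le] at hlt
    -- room `ε`, a rational radius, dense centres
    obtain ⟨q, hq0, hq⟩ := exists_rat_btwn (show (0 : ℝ) < (1 - ‖s - s' + w‖) / 4 by linarith)
    obtain ⟨n, hn⟩ := Metric.denseRange_iff.1 hdense s q hq0
    obtain ⟨m, hm⟩ := Metric.denseRange_iff.1 hdense s' q hq0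
    have hcond : ‖denseSeq E3 n - denseSeq E3 m + w‖ < 1 - 2 * (q : ℝ) := by
      have e : denseSeq E3 n - denseSeq E3 m + w = (s - s' + w) + ((denseSeq E3 n - s) - (denseSeq E3 m - s')) := by abel
      rw [e]
      have h1 : ‖(denseSeq E3 n - s) - (denseSeq E3 m - s')‖ ≤ ‖denseSeq E3 n - s‖ + ‖denseSeq E3 m - s'‖ := norm_sub_le _ _
      have h2 : ‖denseSeq E3 n - s‖ < q := by rw [← dist_eq_norm, dist_comm]; exact hn
      have h3 : ‖denseSeq E3 m - s'‖ < q := by rw [← dist_eq_norm, dist_comm]; exact hm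
      linarith [norm_add_le (s - s' + w) ((denseSeq E3 n - s) - (denseSeq E3 m - s'))]
    rcases h n m q (by exact_mod_cast hq0) hcond with hb | hb
    · exact absurd ((hball _ _).1 hb s hs) (not_le.2 hn)
    · exact absurd ((hball _ _).1 hb s' hs') (not_le.2 hm)
  · -- the property ⇒ countable conditions
    intro h n m r hr hcond
    by_contra hboth
    rw [not_or] at hboth
    obtain ⟨h1, h2⟩ := hboth
    rw [Measure.restrict_apply measurableSet_ball] at h1 h2
    obtain ⟨s, hsb, hs⟩ : (ball (denseSeq E3 n) (r : ℝ) ∩ S).Nonempty :=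
      Set.nonempty_iff_ne_empty.2 fun he => h1 (by rw [he, measure_empty])
    obtain ⟨s', hs'b, hs'⟩ : (ball (denseSeq E3 m) (r : ℝ) ∩ S).Nonempty :=
      Set.nonempty_iff_ne_empty.2 fun he => h2 (by rw [he, measure_empty])
    have hle := h s s' ((hmem s).2 hs) ((hmem s').2 hs')
    have e : s - s' + w = (denseSeq E3 n - denseSeq E3 m + w) + ((s - denseSeq E3 n) - (s' - denseSeq E3 m)) := by abel
    rw [e] at hle
    have h3 : ‖s - denseSeq E3 n‖ < r := by rw [← dist_eq_norm]; exact mem_ball.1 hsb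
    have h4 : ‖s' - denseSeq E3 m‖ < r := by rw [← dist_eq_norm]; exact mem_ball.1 hs'b
    linarith [norm_add_le (denseSeq E3 n - denseSeq E3 m + w) ((s - denseSeq E3 n) - (s' - denseSeq E3 m)),
      norm_sub_le (s - denseSeq E3 n) (s' - denseSeq E3 m)]

/-- The no-pair event is invariant under re-rooting of rooted hard-core configurations. [folklore] -/
theorem unitNoPairEvent_invariant (w : EuclideanSpace ℝ (Fin 3)) :
    ∀ δ : ℝ, 0 < δ → ∀ μ : MeasureTheory.Measure (EuclideanSpace ℝ (Fin 3)), Literature.Probability.Process.IsRootedHardCore δ μ →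
      ∀ p : EuclideanSpace ℝ (Fin 3), μ {p} ≠ 0 → (μ ∈ {ν : Measure E3 | ∀ n m : ℕ, ∀ r : ℚ, (0 : ℝ) < r → ‖denseSeq E3 n - denseSeq E3 m + w‖ < 1 - 2 * (r : ℝ) → ν (ball (denseSeq E3 n) r) = 0 ∨ ν (ball (denseSeq E3 m) r) = 0} ↔ MeasureTheory.Measure.map (fun z : EuclideanSpace ℝ (Fin 3) => z - p) μ ∈ {ν : Measure E3 | ∀ n m : ℕ, ∀ r : ℚ, (0 : ℝ) < r → ‖denseSeq E3 n - denseSeq E3 m + w‖ < 1 - 2 * (r : ℝ) → ν (ball (denseSeq E3 n) r) = 0 ∨ ν (ball (denseSeq E3 m) r) = 0}) := by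
  intro δ _ μ hμ p hp
  rw [mem_unitNoPairEvent_iff hμ w, mem_unitNoPairEvent_iff (hμ.map_sub hp) w]
  obtain ⟨S, h0, hsep, rfl⟩ := hμ
  rw [map_sub_count_restrict]
  simp only [count_restrict_singleton_ne_zero_iff]
  constructor
  · rintro h _ _ ⟨s, hs, rfl⟩ ⟨s', hs', rfl⟩
    simpa using h s s' hs hs'
  · intro h s s' hs hs'
    have := h (s - p) (s' - p) ⟨s, hs, rfl⟩ ⟨s', hs', rfl⟩
    simpa using this


/-! ### The cuts -/

/-- **The no-pair class peeled off the crux.**  Granted the floor of item 9229 (PROVED in the tree), for every `w` the crux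
`AperiodicFrustratedLawGap` (by name) is EQUIVALENT to its restriction to laws almost surely carried by configurations OUTSIDE the no-pair
event — i.e. having two atoms `s, s'` with `‖s − s' + w‖ < 2`: counterexamples to the crux have a 2-relatively-dense difference set.
[folklore] -/
theorem aperiodicFrustratedLawGap_iff_offUnitNoPair
    (hU : ∀ δ' : ℝ, 0 < δ' → ∀ Q : MeasureTheory.Measure (MeasureTheory.Measure (EuclideanSpace ℝ (Fin 3))), MeasureTheory.IsProbabilityMeasure Q →
      (∀ᵐ μ ∂Q, Literature.Probability.Process.IsRootedHardCore δ' μ) → Literature.Probability.Process.IsPointStationaryLaw Q →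
      (⨅ Q : Literature.MathematicalPhysics.StatisticalMechanics.PeriodicConfiguration 3, Q.energyPerParticle Literature.MathematicalPhysics.StatisticalMechanics.lennardJones) ≤
        ∫ μ, Literature.MathematicalPhysics.StatisticalMechanics.rootEnergy Literature.MathematicalPhysics.StatisticalMechanics.lennardJones μ ∂Q)
    (w : EuclideanSpace ℝ (Fin 3)) :
    Summit.AtomisticToContinuum.Crystallization.Theses.FrustratedLawDichotomy.AperiodicFrustratedLawGap ↔
    (∀ δ : ℝ, 0 < δ → ∀ P : MeasureTheory.Measure (MeasureTheory.Measure (EuclideanSpace ℝ (Fin 3))), let Gy : ℝ → (N : ℕ) → (Fin N → EuclideanSpace ℝ (Fin 3)) → Fin N → Prop := fun η N y j => let d : ℝ := sInf ((fun z => dist z (y (j : Fin N))) '' (Set.range (y) \ {(y (j : Fin N))})); let T : Set (EuclideanSpace ℝ (Fin 3)) := {z : EuclideanSpace ℝ (Fin 3) | z ∈ Set.range (y) ∧ z ≠ (y (j : Fin N)) ∧ dist z (y (j : Fin N)) < 13 / 10 * d}; ∃ A : EuclideanSpace ℝ (Fin 3) →ₗᵢ[ℝ] EuclideanSpace ℝ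 (Fin 3), (∃ e : ↥T ≃ ↥Literature.Geometry.DiscreteGeometry.fccKissingPattern, ∀ t : ↥T, dist (d⁻¹ • ((t : EuclideanSpace ℝ (Fin 3)) - (y (j : Fin N)))) (A ((e t : ↥Literature.Geometry.DiscreteGeometry.fccKissingPattern) : EuclideanSpace ℝ (Fin 3))) ≤ η) ∨ (∃ e : ↥T ≃ ↥Literature.Geometry.DiscreteGeometry.hcpKissingPattern, ∀ t : ↥T, dist (d⁻¹ • ((t : EuclideanSpace ℝ (Fin 3)) - (y (j : Fin N)))) (A ((e t : ↥Literature.Geometry.DiscreteGeometry.hcpKissingPattern) : EuclideanSpace ℝ (Fin 3))) ≤ η); let TexBall : (N : ℕ) → (Fin N → EuclideanSpace ℝ (Fin 3)) → Fin N → ℝ → ℝ → ℝ → ℝ → Prop := fun N y i R R₇ R₈ R₉ => (∀ a b : Fin N, a ≠ b → (7 : ℝ) / 10 ≤ dist (y a) (y b)) ∧ (∀ j : Fin N, dist (y j) (y i) ≤ R → ¬ Gy (1 / 20) N (y) j) ∧ (∀ j : Fin N, dist (y j) (y i) ≤ R → ¬ ((∀ j' : Fin N, dist (y j') (y j) ≤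 R₇ → ¬ Gy (1 / 20) N (y) j') ∧ (∀ z : EuclideanSpace ℝ (Fin 3), dist z (y j) ≤ R₇ → ∃ k : Fin N, dist z (y k) ≤ 1) ∧ (∀ j' : Fin N, dist (y j') (y j) ≤ R₇ → (let d : ℝ := sInf ((fun z => dist z (y j')) '' (Set.range (y) \ {(y j')})); ∀ k : Fin N, y k ≠ y j' → dist (y k) (y j') < 27 / 20 * d → 5 ≤ Nat.card {m : Fin N // y m ≠ y j' ∧ dist (y m) (y j') < 27 / 20 * d ∧ y m ≠ y k ∧ dist (y m) (y k) < 27 / 20 * d})))) ∧ (∀ j : Fin N, dist (y j) (y i) ≤ R → ∃ k : Fin N, dist (y k) (y j) ≤ R₈ ∧ Gy (1 / 8) N (y) k) ∧ (∀ j : Fin N, dist (y j) (y i) ≤ R → ¬ ((∀ j' : Fin N, dist (y j') (y j) ≤ R₉ → ¬ Gy (1 / 20) N (y) j') ∧ (Nat.card {j' : Fin N // dist (y j') (y j) ≤ R₉ ∧ ¬ Gy (1 / 8) N (y) j'} : ℝ) ≤ 1 / 2 * (Nat.card {j' : Fin N // dist (y j') (y j) ≤ R₉} : ℝ) ∧ (∀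 j' : Fin N, dist (y j') (y j) ≤ R₉ → ¬ Gy (1 / 8) N (y) j' → ¬ (let d : ℝ := sInf ((fun z => dist z (y j')) '' (Set.range (y) \ {(y j')})); ∀ k : Fin N, y k ≠ y j' → dist (y k) (y j') < 27 / 20 * d → 5 ≤ Nat.card {m : Fin N // y m ≠ y j' ∧ dist (y m) (y j') < 27 / 20 * d ∧ y m ≠ y k ∧ dist (y m) (y k) < 27 / 20 * d})))); let Appr : MeasureTheory.Measure (EuclideanSpace ℝ (Fin 3)) → ℝ → ℝ → ℝ → Prop := fun μ R₇ R₈ R₉ => ∀ q : EuclideanSpace ℝ (Fin 3), μ {q} ≠ 0 → ∀ R ε : ℝ, 0 < ε → ∃ (N : ℕ) (y : Fin N → EuclideanSpace ℝ (Fin 3)) (i : Fin N), TexBall N y i R R₇ R₈ R₉ ∧ (∀ p : EuclideanSpace ℝ (Fin 3), μ {p} ≠ 0 → dist p q ≤ R → ∃ k : Fin N, dist (y k - y i) (p - q) ≤ ε) ∧ (∀ k : Fin N, dist (y k) (y i) ≤ R → ∃ p : EuclideanSpace ℝ (Fin 3), μ {p} ≠ 0 ∧ dist (y k - y i) (p -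 q) ≤ ε); MeasureTheory.IsProbabilityMeasure P → (∀ᵐ μ ∂P, Literature.Probability.Process.IsRootedHardCore δ μ) → Literature.Probability.Process.IsPointStationaryLaw P → (∃ R₇ R₈ R₉ : ℝ, ∀ᵐ μ ∂P, Appr μ R₇ R₈ R₉) → (∀ᵐ μ ∂P, ∀ p : EuclideanSpace ℝ (Fin 3), μ {p} ≠ 0 → ∀ y : EuclideanSpace ℝ (Fin 3), (∀ q : EuclideanSpace ℝ (Fin 3), μ {q} ≠ 0 → q ≠ p → y ≠ q) → ∑' q : {q : EuclideanSpace ℝ (Fin 3) // μ {q} ≠ 0 ∧ q ≠ p}, Literature.MathematicalPhysics.StatisticalMechanics.lennardJones (dist p (q : EuclideanSpace ℝ (Fin 3))) ≤ ∑' q : {q : EuclideanSpace ℝ (Fin 3) // μ {q} ≠ 0 ∧ q ≠ p}, Literature.MathematicalPhysics.StatisticalMechanics.lennardJones (dist y (q : EuclideanSpace ℝ (Fin 3)))) → P {μ : MeasureTheory.Measure (EuclideanSpace ℝ (Fin 3)) | ∃ Q : Literature.MathematicalPhysics.StatisticalMechanics.PeriodicConfiguration 3, ∃ t : EuclideanSpace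 ℝ (Fin 3), {p : EuclideanSpace ℝ (Fin 3) | μ {p} ≠ 0} = (fun s => s + t) '' Q.points} = 0 → (∀ᵐ μ ∂P, μ ∈ ({ν : MeasureTheory.Measure (EuclideanSpace ℝ (Fin 3)) | ∀ n m : ℕ, ∀ r : ℚ, (0 : ℝ) < r → ‖TopologicalSpace.denseSeq (EuclideanSpace ℝ (Fin 3)) n - TopologicalSpace.denseSeq (EuclideanSpace ℝ (Fin 3)) m + w‖ < 1 - 2 * (r : ℝ) → ν (Metric.ball (TopologicalSpace.denseSeq (EuclideanSpace ℝ (Fin 3)) n) r) = 0 ∨ ν (Metric.ball (TopologicalSpace.denseSeq (EuclideanSpace ℝ (Fin 3)) m) r) = 0})ᶜ) → (⨅ Q : Literature.MathematicalPhysics.StatisticalMechanics.PeriodicConfiguration 3, Q.energyPerParticle Literature.MathematicalPhysics.StatisticalMechanics.lennardJones) < (∫ μ, Literature.MathematicalPhysics.StatisticalMechanics.rootEnergy Literature.MathematicalPhysics.StatisticalMechanics.lennardJones μ ∂P)) := by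
  refine aperiodicFrustratedLawGap_cut' _ (measurableSet_unitNoPairEvent w) (unitNoPairEvent_invariant w) ?_
  intro δ hδ P
  dsimp only
  intro _hP ha hb _ _ _ hK
  refine eStar_lt_integral_rootEnergy_of_ae_unitNoPair hU hδ ha hb w ?_
  filter_upwards [ha, hK] with μ hμ hμK
  exact (mem_unitNoPairEvent_iff hμ w).1 hμK


/-- **All no-pair classes peeled off at once**: granted the floor, the crux is equivalent to its restriction to laws almost surely outside the
no-pair event of EVERY offset of the dense sequence. [folklore] -/
theorem aperiodicFrustratedLawGap_iff_offAllUnitNoPair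
    (hU : ∀ δ' : ℝ, 0 < δ' → ∀ Q : MeasureTheory.Measure (MeasureTheory.Measure (EuclideanSpace ℝ (Fin 3))), MeasureTheory.IsProbabilityMeasure Q →
      (∀ᵐ μ ∂Q, Literature.Probability.Process.IsRootedHardCore δ' μ) → Literature.Probability.Process.IsPointStationaryLaw Q →
      (⨅ Q : Literature.MathematicalPhysics.StatisticalMechanics.PeriodicConfiguration 3, Q.energyPerParticle Literature.MathematicalPhysics.StatisticalMechanics.lennardJones) ≤
        ∫ μ, Literature.MathematicalPhysics.StatisticalMechanics.rootEnergy Literature.MathematicalPhysics.StatisticalMechanics.lennardJones μ ∂Q) :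
    Summit.AtomisticToContinuum.Crystallization.Theses.FrustratedLawDichotomy.AperiodicFrustratedLawGap ↔
    (∀ δ : ℝ, 0 < δ → ∀ P : MeasureTheory.Measure (MeasureTheory.Measure (EuclideanSpace ℝ (Fin 3))), let Gy : ℝ → (N : ℕ) → (Fin N → EuclideanSpace ℝ (Fin 3)) → Fin N → Prop := fun η N y j => let d : ℝ := sInf ((fun z => dist z (y (j : Fin N))) '' (Set.range (y) \ {(y (j : Fin N))})); let T : Set (EuclideanSpace ℝ (Fin 3)) := {z : EuclideanSpace ℝ (Fin 3) | z ∈ Set.range (y) ∧ z ≠ (y (j : Fin N)) ∧ dist z (y (j : Fin N)) < 13 / 10 * d}; ∃ A : EuclideanSpace ℝ (Fin 3) →ₗᵢ[ℝ] EuclideanSpace ℝ (Fin 3), (∃ e : ↥T ≃ ↥Literature.Geometry.DiscreteGeometry.fccKissingPattern, ∀ t : ↥T, dist (d⁻¹ • ((t : EuclideanSpace ℝ (Fin 3)) - (y (j : Fin N)))) (A ((e t : ↥Literature.Geometry.DiscreteGeometry.fccKissingPattern) : EuclideanSpace ℝ (Fin 3))) ≤ η) ∨ (∃ e : ↥T ≃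 ↥Literature.Geometry.DiscreteGeometry.hcpKissingPattern, ∀ t : ↥T, dist (d⁻¹ • ((t : EuclideanSpace ℝ (Fin 3)) - (y (j : Fin N)))) (A ((e t : ↥Literature.Geometry.DiscreteGeometry.hcpKissingPattern) : EuclideanSpace ℝ (Fin 3))) ≤ η); let TexBall : (N : ℕ) → (Fin N → EuclideanSpace ℝ (Fin 3)) → Fin N → ℝ → ℝ → ℝ → ℝ → Prop := fun N y i R R₇ R₈ R₉ => (∀ a b : Fin N, a ≠ b → (7 : ℝ) / 10 ≤ dist (y a) (y b)) ∧ (∀ j : Fin N, dist (y j) (y i) ≤ R → ¬ Gy (1 / 20) N (y) j) ∧ (∀ j : Fin N, dist (y j) (y i) ≤ R → ¬ ((∀ j' : Fin N, dist (y j') (y j) ≤ R₇ → ¬ Gy (1 / 20) N (y) j') ∧ (∀ z : EuclideanSpace ℝ (Fin 3), dist z (y j) ≤ R₇ → ∃ k : Fin N, dist z (y k) ≤ 1) ∧ (∀ j' : Fin N, dist (y j') (y j) ≤ R₇ → (let d : ℝ := sInf ((fun z => dist z (y j')) '' (Set.range (y) \ {(y j')})); ∀ k : Fin N, y k ≠ y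 j' → dist (y k) (y j') < 27 / 20 * d → 5 ≤ Nat.card {m : Fin N // y m ≠ y j' ∧ dist (y m) (y j') < 27 / 20 * d ∧ y m ≠ y k ∧ dist (y m) (y k) < 27 / 20 * d})))) ∧ (∀ j : Fin N, dist (y j) (y i) ≤ R → ∃ k : Fin N, dist (y k) (y j) ≤ R₈ ∧ Gy (1 / 8) N (y) k) ∧ (∀ j : Fin N, dist (y j) (y i) ≤ R → ¬ ((∀ j' : Fin N, dist (y j') (y j) ≤ R₉ → ¬ Gy (1 / 20) N (y) j') ∧ (Nat.card {j' : Fin N // dist (y j') (y j) ≤ R₉ ∧ ¬ Gy (1 / 8) N (y) j'} : ℝ) ≤ 1 / 2 * (Nat.card {j' : Fin N // dist (y j') (y j) ≤ R₉} : ℝ) ∧ (∀ j' : Fin N, dist (y j') (y j) ≤ R₉ → ¬ Gy (1 / 8) N (y) j' → ¬ (let d : ℝ := sInf ((fun z => dist z (y j')) '' (Set.range (y) \ {(y j')})); ∀ k : Fin N, y k ≠ y j' → dist (y k) (y j') < 27 / 20 * d → 5 ≤ Nat.card {m : Fin N // y m ≠ y j' ∧ dist (y m) (y j') < 27 / 20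 * d ∧ y m ≠ y k ∧ dist (y m) (y k) < 27 / 20 * d})))); let Appr : MeasureTheory.Measure (EuclideanSpace ℝ (Fin 3)) → ℝ → ℝ → ℝ → Prop := fun μ R₇ R₈ R₉ => ∀ q : EuclideanSpace ℝ (Fin 3), μ {q} ≠ 0 → ∀ R ε : ℝ, 0 < ε → ∃ (N : ℕ) (y : Fin N → EuclideanSpace ℝ (Fin 3)) (i : Fin N), TexBall N y i R R₇ R₈ R₉ ∧ (∀ p : EuclideanSpace ℝ (Fin 3), μ {p} ≠ 0 → dist p q ≤ R → ∃ k : Fin N, dist (y k - y i) (p - q) ≤ ε) ∧ (∀ k : Fin N, dist (y k) (y i) ≤ R → ∃ p : EuclideanSpace ℝ (Fin 3), μ {p} ≠ 0 ∧ dist (y k - y i) (p - q) ≤ ε); MeasureTheory.IsProbabilityMeasure P → (∀ᵐ μ ∂P, Literature.Probability.Process.IsRootedHardCore δ μ) → Literature.Probability.Process.IsPointStationaryLaw P → (∃ R₇ R₈ R₉ : ℝ, ∀ᵐ μ ∂P, Appr μ R₇ R₈ R₉) → (∀ᵐ μ ∂P, ∀ p : EuclideanSpace ℝ (Fin 3),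 μ {p} ≠ 0 → ∀ y : EuclideanSpace ℝ (Fin 3), (∀ q : EuclideanSpace ℝ (Fin 3), μ {q} ≠ 0 → q ≠ p → y ≠ q) → ∑' q : {q : EuclideanSpace ℝ (Fin 3) // μ {q} ≠ 0 ∧ q ≠ p}, Literature.MathematicalPhysics.StatisticalMechanics.lennardJones (dist p (q : EuclideanSpace ℝ (Fin 3))) ≤ ∑' q : {q : EuclideanSpace ℝ (Fin 3) // μ {q} ≠ 0 ∧ q ≠ p}, Literature.MathematicalPhysics.StatisticalMechanics.lennardJones (dist y (q : EuclideanSpace ℝ (Fin 3)))) → P {μ : MeasureTheory.Measure (EuclideanSpace ℝ (Fin 3)) | ∃ Q : Literature.MathematicalPhysics.StatisticalMechanics.PeriodicConfiguration 3, ∃ t : EuclideanSpace ℝ (Fin 3), {p : EuclideanSpace ℝ (Fin 3) | μ {p} ≠ 0} = (fun s => s + t) '' Q.points} = 0 → (∀ᵐ μ ∂P, μ ∈ (⋃ i : ℕ, {ν : MeasureTheory.Measure (EuclideanSpace ℝ (Fin 3)) | ∀ n m : ℕ, ∀ r : ℚ, (0 : ℝ) < r → ‖TopologicalSpace.denseSeq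 (EuclideanSpace ℝ (Fin 3)) n - TopologicalSpace.denseSeq (EuclideanSpace ℝ (Fin 3)) m + TopologicalSpace.denseSeq (EuclideanSpace ℝ (Fin 3)) i‖ < 1 - 2 * (r : ℝ) → ν (Metric.ball (TopologicalSpace.denseSeq (EuclideanSpace ℝ (Fin 3)) n) r) = 0 ∨ ν (Metric.ball (TopologicalSpace.denseSeq (EuclideanSpace ℝ (Fin 3)) m) r) = 0})ᶜ) → (⨅ Q : Literature.MathematicalPhysics.StatisticalMechanics.PeriodicConfiguration 3, Q.energyPerParticle Literature.MathematicalPhysics.StatisticalMechanics.lennardJones) < (∫ μ, Literature.MathematicalPhysics.StatisticalMechanics.rootEnergy Literature.MathematicalPhysics.StatisticalMechanics.lennardJones μ ∂P)) := by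
  refine aperiodicFrustratedLawGap_cut_iUnion _ (fun i => measurableSet_unitNoPairEvent (denseSeq E3 i))
    (fun i => unitNoPairEvent_invariant (denseSeq E3 i)) fun i => ?_
  intro δ hδ P
  dsimp only
  intro _hP ha hb _ _ _ hK
  refine eStar_lt_integral_rootEnergy_of_ae_unitNoPair hU hδ ha hb (denseSeq E3 i) ?_
  filter_upwards [ha, hK] with μ hμ hμK
  exact (mem_unitNoPairEvent_iff hμ (denseSeq E3 i)).1 hμK

/-- **Counterexamples have a 1-relatively-dense difference set**: granted the floor, the crux (by name) is equivalent to its restriction to laws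
almost surely carried by configurations whose difference set comes within `2 + ε` of every vector: for every `v ∈ ℝ³` and `ε > 0` there are
atoms `s, s'` with `‖s − s' + v‖ < 1 + ε`. [folklore] -/
theorem aperiodicFrustratedLawGap_iff_unitDenseDifferences
    (hU : ∀ δ' : ℝ, 0 < δ' → ∀ Q : MeasureTheory.Measure (MeasureTheory.Measure (EuclideanSpace ℝ (Fin 3))), MeasureTheory.IsProbabilityMeasure Q →
      (∀ᵐ μ ∂Q, Literature.Probability.Process.IsRootedHardCore δ' μ) → Literature.Probability.Process.IsPointStationaryLaw Q →
      (⨅ Q : Literature.MathematicalPhysics.StatisticalMechanics.PeriodicConfiguration 3, Q.energyPerParticle Literature.MathematicalPhysics.StatisticalMechanics.lennardJones) ≤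
        ∫ μ, Literature.MathematicalPhysics.StatisticalMechanics.rootEnergy Literature.MathematicalPhysics.StatisticalMechanics.lennardJones μ ∂Q) :
    Summit.AtomisticToContinuum.Crystallization.Theses.FrustratedLawDichotomy.AperiodicFrustratedLawGap ↔
    (∀ δ : ℝ, 0 < δ → ∀ P : MeasureTheory.Measure (MeasureTheory.Measure (EuclideanSpace ℝ (Fin 3))), let Gy : ℝ → (N : ℕ) → (Fin N → EuclideanSpace ℝ (Fin 3)) → Fin N → Prop := fun η N y j => let d : ℝ := sInf ((fun z => dist z (y (j : Fin N))) '' (Set.range (y) \ {(y (j : Fin N))})); let T : Set (EuclideanSpace ℝ (Fin 3)) := {z : EuclideanSpace ℝ (Fin 3) | z ∈ Set.range (y) ∧ z ≠ (y (j : Fin N)) ∧ dist z (y (j : Fin N)) < 13 / 10 * d}; ∃ A : EuclideanSpace ℝ (Fin 3) →ₗᵢ[ℝ] EuclideanSpace ℝ (Fin 3), (∃ e : ↥T ≃ ↥Literature.Geometry.DiscreteGeometry.fccKissingPattern, ∀ t : ↥T, dist (d⁻¹ • ((t : EuclideanSpace ℝ (Fin 3)) - (y (j : Fin N)))) (A ((e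 t : ↥Literature.Geometry.DiscreteGeometry.fccKissingPattern) : EuclideanSpace ℝ (Fin 3))) ≤ η) ∨ (∃ e : ↥T ≃ ↥Literature.Geometry.DiscreteGeometry.hcpKissingPattern, ∀ t : ↥T, dist (d⁻¹ • ((t : EuclideanSpace ℝ (Fin 3)) - (y (j : Fin N)))) (A ((e t : ↥Literature.Geometry.DiscreteGeometry.hcpKissingPattern) : EuclideanSpace ℝ (Fin 3))) ≤ η); let TexBall : (N : ℕ) → (Fin N → EuclideanSpace ℝ (Fin 3)) → Fin N → ℝ → ℝ → ℝ → ℝ → Prop := fun N y i R R₇ R₈ R₉ => (∀ a b : Fin N, a ≠ b → (7 : ℝ) / 10 ≤ dist (y a) (y b)) ∧ (∀ j : Fin N, dist (y j) (y i) ≤ R → ¬ Gy (1 / 20) N (y) j) ∧ (∀ j : Fin N, dist (y j) (y i) ≤ R → ¬ ((∀ j' : Fin N, dist (y j') (y j) ≤ R₇ → ¬ Gy (1 / 20) N (y) j') ∧ (∀ z : EuclideanSpace ℝ (Fin 3), dist z (y j) ≤ R₇ → ∃ k : Fin N, dist z (y k) ≤ 1) ∧ (∀ j' : Fin N, dist (y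 j') (y j) ≤ R₇ → (let d : ℝ := sInf ((fun z => dist z (y j')) '' (Set.range (y) \ {(y j')})); ∀ k : Fin N, y k ≠ y j' → dist (y k) (y j') < 27 / 20 * d → 5 ≤ Nat.card {m : Fin N // y m ≠ y j' ∧ dist (y m) (y j') < 27 / 20 * d ∧ y m ≠ y k ∧ dist (y m) (y k) < 27 / 20 * d})))) ∧ (∀ j : Fin N, dist (y j) (y i) ≤ R → ∃ k : Fin N, dist (y k) (y j) ≤ R₈ ∧ Gy (1 / 8) N (y) k) ∧ (∀ j : Fin N, dist (y j) (y i) ≤ R → ¬ ((∀ j' : Fin N, dist (y j') (y j) ≤ R₉ → ¬ Gy (1 / 20) N (y) j') ∧ (Nat.card {j' : Fin N // dist (y j') (y j) ≤ R₉ ∧ ¬ Gy (1 / 8) N (y) j'} : ℝ) ≤ 1 / 2 * (Nat.card {j' : Fin N // dist (y j') (y j) ≤ R₉} : ℝ) ∧ (∀ j' : Fin N, dist (y j') (y j) ≤ R₉ → ¬ Gy (1 / 8) N (y) j' → ¬ (let d : ℝ := sInf ((fun z => dist z (y j')) '' (Set.range (y) \ {(y j')})); ∀ k : Fin N, y k ≠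 y j' → dist (y k) (y j') < 27 / 20 * d → 5 ≤ Nat.card {m : Fin N // y m ≠ y j' ∧ dist (y m) (y j') < 27 / 20 * d ∧ y m ≠ y k ∧ dist (y m) (y k) < 27 / 20 * d})))); let Appr : MeasureTheory.Measure (EuclideanSpace ℝ (Fin 3)) → ℝ → ℝ → ℝ → Prop := fun μ R₇ R₈ R₉ => ∀ q : EuclideanSpace ℝ (Fin 3), μ {q} ≠ 0 → ∀ R ε : ℝ, 0 < ε → ∃ (N : ℕ) (y : Fin N → EuclideanSpace ℝ (Fin 3)) (i : Fin N), TexBall N y i R R₇ R₈ R₉ ∧ (∀ p : EuclideanSpace ℝ (Fin 3), μ {p} ≠ 0 → dist p q ≤ R → ∃ k : Fin N, dist (y k - y i) (p - q) ≤ ε) ∧ (∀ k : Fin N, dist (y k) (y i) ≤ R → ∃ p : EuclideanSpace ℝ (Fin 3), μ {p} ≠ 0 ∧ dist (y k - y i) (p - q) ≤ ε); MeasureTheory.IsProbabilityMeasure P → (∀ᵐ μ ∂P, Literature.Probability.Process.IsRootedHardCore δ μ) → Literature.Probability.Process.IsPointStationaryLaw P → (∃ R₇ R₈ R₉ : ℝ,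 ∀ᵐ μ ∂P, Appr μ R₇ R₈ R₉) → (∀ᵐ μ ∂P, ∀ p : EuclideanSpace ℝ (Fin 3), μ {p} ≠ 0 → ∀ y : EuclideanSpace ℝ (Fin 3), (∀ q : EuclideanSpace ℝ (Fin 3), μ {q} ≠ 0 → q ≠ p → y ≠ q) → ∑' q : {q : EuclideanSpace ℝ (Fin 3) // μ {q} ≠ 0 ∧ q ≠ p}, Literature.MathematicalPhysics.StatisticalMechanics.lennardJones (dist p (q : EuclideanSpace ℝ (Fin 3))) ≤ ∑' q : {q : EuclideanSpace ℝ (Fin 3) // μ {q} ≠ 0 ∧ q ≠ p}, Literature.MathematicalPhysics.StatisticalMechanics.lennardJones (dist y (q : EuclideanSpace ℝ (Fin 3)))) → P {μ : MeasureTheory.Measure (EuclideanSpace ℝ (Fin 3)) | ∃ Q : Literature.MathematicalPhysics.StatisticalMechanics.PeriodicConfiguration 3, ∃ t : EuclideanSpace ℝ (Fin 3), {p : EuclideanSpace ℝ (Fin 3) | μ {p} ≠ 0} = (fun s => s + t) '' Q.points} = 0 → (∀ᵐ μ ∂P, ∀ v : EuclideanSpace ℝ (Fin 3), ∀ ε :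 ℝ, 0 < ε → ∃ s s' : EuclideanSpace ℝ (Fin 3), μ {s} ≠ 0 ∧ μ {s'} ≠ 0 ∧ ‖s - s' + v‖ < 1 + ε) → (⨅ Q : Literature.MathematicalPhysics.StatisticalMechanics.PeriodicConfiguration 3, Q.energyPerParticle Literature.MathematicalPhysics.StatisticalMechanics.lennardJones) < (∫ μ, Literature.MathematicalPhysics.StatisticalMechanics.rootEnergy Literature.MathematicalPhysics.StatisticalMechanics.lennardJones μ ∂P)) := by
  constructor
  · intro h δ hδ P
    have h' := h δ hδ P
    dsimp only at h' ⊢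
    intro hP ha hb hd he h0 _
    exact h' hP ha hb hd he h0
  · intro h
    rw [aperiodicFrustratedLawGap_iff_offAllUnitNoPair hU]
    intro δ hδ P
    have h' := h δ hδ P
    dsimp only at h' ⊢
    intro hP ha hb hd he h0 hoff
    refine h' hP ha hb hd he h0 ?_
    filter_upwards [ha, hoff] with μ hμ hμoff
    intro v ε hε
    obtain ⟨i, hi⟩ := Metric.denseRange_iff.1 (denseRange_denseSeq E3) v ε hε
    rw [Set.mem_compl_iff, Set.mem_iUnion, not_exists] at hμoff
    have hi' := hμoff i
    rw [mem_unitNoPairEvent_iff hμ (denseSeq E3 i)] at hi'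
    push Not at hi'
    obtain ⟨s, s', hs, hs', hlt⟩ := hi'
    refine ⟨s, s', hs, hs', ?_⟩
    have e : s - s' + v = (s - s' + denseSeq E3 i) + (v - denseSeq E3 i) := by abel
    rw [e]
    have hv : ‖v - denseSeq E3 i‖ < ε := by rw [← dist_eq_norm]; exact hi
    linarith [norm_add_le (s - s' + denseSeq E3 i) (v - denseSeq E3 i)]


end UnitNoPair

end Summit.AtomisticToContinuum.Crystallization.Theorems.FrustratedLawDichotomyAperiodicGapFiniteCut

end
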